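import Summits.BirchSwinnertonDyer.Rank1Residual.X11b.BDPRouteLevelToKummer
import Summits.BirchSwinnertonDyer.Rank1Residual.X11b.BDPRouteLocalIndexSymmetry
import Summits.BirchSwinnertonDyer.Rank1Residual.X11b.BDPRouteRelaxation
import Summits.BirchSwinnertonDyer.Rank1Residual.X11b.BDPRouteStrictAtPlace
import HarnessLib

/-!
# X11b, route p2 — the LEVEL-`k` BOUND of the input (d): `#H¹_{𝓛^{(k)}}(K, E[p^k])` from the glue,
# Part A (strict at `𝔭`), Part B (relaxed at `𝔭̄`) and the `𝔭 ↔ 𝔭̄` symmetry (plumbing item (vii), level part)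

HONEST FRAMING (cell `b2b-bsdres`, run/shared/lean/b2b/bsd-rank1-residual/, verbatim in every
file): the goal of the cell is to DELETE the COMBINATION-SHAPED residual classes of the
Birch–Swinnerton-Dyer formula for ALL analytic-rank `≤ 1` elliptic curves over `ℚ` — "full BSD
formula for every rank `≤ 1` curve in class `C`" assembled STRICTLY from published theorems — so
that the rank-`≤ 1` remainder becomes exactly the CONSTRUCTION-SHAPED classes, which are TYPED
(missing-input `Prop`s), NOT attempted. This is not "finishing BSD". Sub-cell
`b2b-bsdres-multr1-p2` (X11b, route p2 = BDP + converse + Kolyvagin; the JSW17 Prop. 3.2.1 "≤"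
half (d) `P2SelmerCardBoundAt`); a RESEARCH ROUTE; no claim beyond the stated class; X11b stays
CONSTRUCTION-SHAPED; nothing here changes a label; no named fact is minted (theorems only; no
`sorry`; the two TEXTBOOK named facts Poitou–Tate `poitouTate_sum_localTatePairing_eq_zero`
(Milne ADT I 4.10(b)) and `localEulerPoincareCharacteristic` (Milne ADT I 2.8) enter as hypotheses).

## What is here

For `W/ℚ` elliptic, a number field `K`, a prime `p`, a level `n = p^k` (`k ≥ 1`), two finite places
`𝔭 ≠ 𝔮` of `K` conjugate under some `σ ∈ Aut(K/ℚ)` and such that every place above `p` is `𝔭` or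
`𝔮` (the split quadratic situation `p = 𝔭𝔭̄`), and the (iv)-type vanishing `E[p^∞](K̄)^{Γ_{K_𝔭}} = 0`:

* `finite_kummerOutside` — `H¹(G_T, E[n])` in the Kummer presentation (`kummerOutside`) is finite
  (it maps to the finite `∏_{v∈T} H¹(K_v, E[n])` with kernel inside the finite `Sel⁽ⁿ⁾(E/K)`);
* `natCard_inf_le_relIndex_mul` — `#(A ∩ C) ≤ [A : S]·#(S ∩ C)` for `S ≤ A` (`A` finite);
* **`natCard_level_le_of_indices`** — THE LEVEL BOUND:
  `#H¹_{𝓛^{(k)}}(K, E[p^k]) ≤ L · (S · L)` whenever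
  `[E(K_𝔭) : p^k E(K_𝔭) + im E(K)] = L`, `[E(K_𝔭) : p^k E(K_𝔭)] = M = [E(K) : p^k E(K)] ≠ 0` and
  `#Ш(E/K)[p^k] ≤ S`: the glue `H¹_{𝓛^{(k)}} ≤ H¹_{𝓛,⊤ at 𝔮} ∩ ker loc_𝔭`
  (`LevelKummer.selmerGroup_acLevelStructure_le_inf`), Part B
  `[H¹_{𝓛,⊤ at 𝔮} : Sel⁽ⁿ⁾] ≤ [E(K_𝔮) : nE(K_𝔮) + im E(K)]` (`Relaxation`, from the two textbook
  facts), the symmetry `[E(K_𝔮) : …] = [E(K_𝔭) : …]` (`LocalIndexSymmetry`), and Part A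
  `#(Sel⁽ⁿ⁾ ∩ ker res_𝔭)·M ≤ #Ш[n]·M·L` (`StrictAtPlace`). This is Jetchev–Skinner–Wan 2017
  Prop. 3.2.1 (`≤`) at finite level with the indices left symbolic; `BDPRouteSelmerCardBound`
  evaluates them (`L = p^{min(k,e)}`, `M = p^k`, `S = #Ш[p^∞]`).

References: [JetchevSkinnerWan2017] Prop. 3.2.1 (arXiv:1512.06894 pp. 10–11); [Castella2018]
(3.2.1) and (calcul) (arXiv:1704.06608 pp. 5–6); [MilneADT2006] I Thm. 2.8, Thm. 4.10(b), Lemma 6.15.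
-/

noncomputable section

open scoped Classical

universe u

namespace Summit.BirchSwinnertonDyer.Rank1Residual.X11b.SelmerLevelBound

open WeierstrassCurve NumberField IsDedekindDomain Field Function
open Literature.NumberTheory.EllipticCurves Literature.NumberTheory.EllipticCurves.GreenbergSelmer
open Literature.NumberTheory.GaloisRepresentations Literature.NumberTheory.GaloisCohomology
open Summit.BirchSwinnertonDyer.Rank1Residual.X11b.AcSelmer
open Summit.BirchSwinnertonDyer.Rank1Residual.X11b.LocBridge

/-! ## §1. Two generic counting facts -/

section Generic

variable {X : Type*} [AddCommGroup X]

/-- **`#(A ∩ C) ≤ [A : S] · #(S ∩ C)` for `S ≤ A`, `A` finite**: the inclusion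
`(A ∩ C)/(S ∩ C) ↪ A/S`. [folklore] -/
theorem natCard_inf_le_relIndex_mul (A S C : AddSubgroup X) (hSA : S ≤ A) [Finite A] :
    Nat.card ↥(A ⊓ C) ≤ S.relIndex A * Nat.card ↥(S ⊓ C) := by
  haveI : Finite ↥(A ⊓ C) := Finite.of_injective _ (AddSubgroup.inclusion_injective inf_le_left)
  -- `#(A ⊓ C) = #((S ⊓ C) ∩ (A ⊓ C)) · [(A ⊓ C) : (S ⊓ C)]`
  have h1 : Nat.card ((S ⊓ C).addSubgroupOf (A ⊓ C)) * (S ⊓ C).relIndex (A ⊓ C) =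
      Nat.card ↥(A ⊓ C) := AddSubgroup.card_mul_index _
  -- the first factor is at most `#(S ⊓ C)`
  have h2 : Nat.card ((S ⊓ C).addSubgroupOf (A ⊓ C)) ≤ Nat.card ↥(S ⊓ C) := by
    haveI : Finite ↥(S ⊓ C) :=
      Finite.of_injective _ (AddSubgroup.inclusion_injective (inf_le_inf_right C hSA))
    refine Nat.card_le_card_of_injective (fun x => ⟨x.1.1, x.2⟩) ?_
    intro x y hxy
    apply Subtype.ext; apply Subtype.ext
    exact congrArg (fun z : ↥(S ⊓ C) => (z : X)) hxy
  -- the second factor is `[A ⊓ C : S] ≤ [A : S]`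
  have h3 : (S ⊓ C).relIndex (A ⊓ C) = S.relIndex (A ⊓ C) := by
    rw [AddSubgroup.relIndex, AddSubgroup.relIndex]
    congr 1
    ext x
    simp only [AddSubgroup.mem_addSubgroupOf, AddSubgroup.mem_inf]
    exact ⟨fun h => h.1, fun h => ⟨h, x.2.2⟩⟩
  have h4 : S.relIndex (A ⊓ C) ≤ S.relIndex A :=
    AddSubgroup.relIndex_le_of_le_right inf_le_left
      (AddSubgroup.FiniteIndex.index_ne_zero (H := S.addSubgroupOf A))
  calc Nat.card ↥(A ⊓ C)
      = Nat.card ((S ⊓ C).addSubgroupOf (A ⊓ C)) * (S ⊓ C).relIndex (A ⊓ C) := h1.symm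
    _ ≤ Nat.card ↥(S ⊓ C) * S.relIndex A := by
        rw [h3]; exact Nat.mul_le_mul h2 h4
    _ = S.relIndex A * Nat.card ↥(S ⊓ C) := mul_comm _ _

end Generic

/-! ## §2. `H¹(G_T, E[n])` is finite -/

section Finite

variable {K : Type u} [Field K] [NumberField K] (W : WeierstrassCurve K) [W.IsElliptic]
  (m : ℕ) [NeZero m]

/-- **`kummerOutside W m T` is finite**: it maps by `loc_T` to the finite
`∏_{v∈T} H¹(K_v, E[m])` (`finite_localClasses`), and a class with `loc_T = 0` is a Selmer class
(`mem_selmerGroup_of_mem_kummerOutside`), the Selmer group being finite (`finite_selmerGroup_holds`).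
[cite: MilneADT2006, Ch. I, Lemma 6.15 and Cor. 4.15] -/
theorem finite_kummerOutside (T : Finset (Place K)) : Finite (kummerOutside W m T) := by
  haveI := finite_localClasses W m T
  haveI : Finite (selmerGroup W (m : ℤ)) :=
    W.finite_selmerGroup_holds (Int.natCast_ne_zero.mpr (NeZero.ne m))
  set f : kummerOutside W m T →+ LocalClasses W m T := (locS W m T).comp (kummerOutside W m T).subtype
    with hf
  rw [AddMonoidHom.finite_iff_finite_ker_range f]
  refine ⟨?_, inferInstance⟩
  -- the kernel embeds in the Selmer group
  have hker : ∀ x : f.ker, x.1.1 ∈ selmerGroup W (m : ℤ) := fun x =>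
    mem_selmerGroup_of_mem_kummerOutside W m x.1.2 fun v => by
      have hx : f x.1 = 0 := (AddMonoidHom.mem_ker).mp x.2
      have h0 : locS W m T x.1.1 v = 0 := congr_fun hx v
      rw [h0]
      exact AddSubgroup.zero_mem _
  exact Finite.of_injective (fun x : f.ker => (⟨x.1.1, hker x⟩ : selmerGroup W (m : ℤ)))
    fun x y hxy => by
      apply Subtype.ext; apply Subtype.ext
      exact congrArg (fun z : selmerGroup W (m : ℤ) => (z : galH1Torsion W (m : ℤ))) hxy

end Finite

/-! ## §3. The level bound -/

section Level

variable (W : WeierstrassCurve ℚ) [W.IsElliptic] (K : Type) [Field K] [NumberField K]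
  (p k : ℕ) [Fact p.Prime] (𝔭 𝔮 : HeightOneSpectrum (𝓞 K))

/-- **THE LEVEL BOUND (JSW17 Prop. 3.2.1 `≤` at level `p^k`, indices symbolic).** Let `k ≥ 1`,
`𝔭 ≠ 𝔮` conjugate places (`σ • 𝔭 = 𝔮`) with every place above `p` equal to `𝔭` or `𝔮`, and
`E[p^∞](K̄)^{Γ_{K_𝔭}} = 0`. If `[E(K_𝔭) : p^kE(K_𝔭) + im E(K)] = L`,
`[E(K_𝔭) : p^kE(K_𝔭)] = M = [E(K) : p^kE(K)]` with `M ≠ 0`, and `#Ш(E/K)[p^k] ≤ S`, then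
Castella's level-`k` group satisfies `#H¹_{𝓛^{(k)}}(K, E[p^k]) ≤ L · (S · L)` — from the two
textbook facts (Poitou–Tate, local Euler characteristic at `K_𝔮`).
[cite: JetchevSkinnerWan2017, Prop. 3.2.1 (proof, arXiv:1512.06894 pp. 10–11)]
[cite: Castella2018, proof of Thm. 2.3, (3.2.1) (arXiv:1704.06608 pp. 5–6)]
[cite: MilneADT2006, Ch. I, Thm. 4.10(b) and Thm. 2.8] -/
theorem natCard_level_le_of_indices (hk : 0 < k) (σ : K ≃ₐ[ℚ] K) (hσ : σ • 𝔭 = 𝔮)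
    (h𝔮 : ∀ v : HeightOneSpectrum (𝓞 K), v ≠ 𝔭 → ((p : ℕ) : 𝓞 K) ∈ v.asIdeal → v = 𝔮)
    (hΓ : ∀ Q : (W.baseChange K).geomPrimaryTorsion p,
      (∀ τ : absoluteGaloisGroup (Place.Completion (Sum.inr 𝔭 : Place K)),
        GaloisRep.restrictField (Place.Completion (Sum.inr 𝔭 : Place K))
          (primaryGaloisModule (W.baseChange K) p) τ Q = Q) → Q = 0)
    (hPT : poitouTate_sum_localTatePairing_eq_zero K)
    (hEP : localEulerPoincareCharacteristic (𝔮.adicCompletion K))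
    {L M S : ℕ}
    (hL : ((Affine.Point.baseChange (W' := W.baseChange K) K (𝔭.adicCompletion K)).range ⊔
        (zsmulAddGroupHom ((p ^ k : ℕ) : ℤ) :
          ((W.baseChange K).baseChange (𝔭.adicCompletion K)).toAffine.Point →+ _).range).index = L)
    (hM : ((zsmulAddGroupHom ((p ^ k : ℕ) : ℤ) :
        ((W.baseChange K).baseChange (𝔭.adicCompletion K)).toAffine.Point →+ _).range).index = M)
    (hM0 : M ≠ 0)
    (hN : ((zsmulAddGroupHom ((p ^ k : ℕ) : ℤ) : (W.baseChange K).toAffine.Point →+ _).range).index = M)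
    (hS : Nat.card ↥((W.baseChange K).sha ⊓
        AddSubgroup.torsionBy (W.baseChange K).galH1 ((p ^ k : ℕ) : ℤ)) ≤ S) :
    Finite (acLevelStructure (W.baseChange K) p k 𝔭 ∅).selmerGroup ∧
      Nat.card (acLevelStructure (W.baseChange K) p k 𝔭 ∅).selmerGroup ≤ L * (S * L) := by
  haveI hEK : (W.baseChange K).IsElliptic := by rw [baseChange]; infer_instance
  haveI : NeZero (p ^ k) := ⟨pow_ne_zero _ (Fact.out : p.Prime).ne_zero⟩
  haveI : CharZero (𝔭.adicCompletion K) := charZero_adicCompletion 𝔭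
  have hnZ : ((p ^ k : ℕ) : ℤ) ≠ 0 := Int.natCast_ne_zero.mpr (NeZero.ne _)
  set E := W.baseChange K with hE
  set n : ℕ := p ^ k with hn
  set Sel := selmerGroup E (n : ℤ) with hSel
  set KO := kummerOutside E n {Sum.inr 𝔮} with hKO
  set kerloc := (galoisCohomology.localization (E.torsionGaloisModule (n : ℤ)) (Sum.inr 𝔭) 1).ker
    with hkerloc
  -- (1) glue
  have hT : ∀ v : HeightOneSpectrum (𝓞 K), v ≠ 𝔭 →
      (((p : ℕ) : 𝓞 K) ∈ v.asIdeal ∨ v ∈ (∅ : Set (HeightOneSpectrum (𝓞 K)))) →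
        (Sum.inr v : Place K) ∈ ({Sum.inr 𝔮} : Finset (Place K)) := by
    rintro v hv (hpv | hv0)
    · rw [h𝔮 v hv hpv, Finset.mem_singleton]
    · exact absurd hv0 (Set.notMem_empty v)
  haveI hKOfin : Finite KO := finite_kummerOutside E n {Sum.inr 𝔮}
  haveI : Finite ↥(KO ⊓ kerloc) := Finite.of_injective _ (AddSubgroup.inclusion_injective inf_le_left)
  obtain ⟨hfin, hglue⟩ :=
    LevelKummer.finite_and_natCard_selmerGroup_acLevelStructure_le E p k 𝔭 ∅ {Sum.inr 𝔮} hT hΓ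
  refine ⟨hfin, hglue.trans ?_⟩
  -- (2) `#(KO ⊓ kerloc) ≤ [KO : Sel] · #(Sel ⊓ kerloc)`
  have hSelKO : Sel ≤ KO := selmerGroup_le_kummerOutside E n _
  refine (natCard_inf_le_relIndex_mul KO Sel kerloc hSelKO).trans ?_
  -- (3) Part B at `𝔮`, then the symmetry `𝔮 ↔ 𝔭`
  have hpp : IsPrimePow n := ⟨p, k, (Fact.out : p.Prime).prime, hk, rfl⟩
  have hB : Sel.relIndex KO ≤ L := by
    have h := Relaxation.relIndex_selmerGroup_kummerOutside_le_of_facts E n 𝔮 hpp hPT hEP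
    rw [← LocalIndexSymmetry.index_range_baseChange_sup_eq_of_algEquiv_smul W σ hσ (n : ℤ), hL] at h
    exact h
  -- (4) Part A at `𝔭`
  have hA : Nat.card ↥(Sel ⊓ kerloc) ≤ S * L := by
    have hdiv := E.zsmul_geomPoints_surjective_holds hnZ
    have h := StrictAtPlace.natCard_selmerGroup_inf_ker_res_mul_index_le E (𝔭.adicCompletion K) hnZ
      hdiv
    change Nat.card ↥(Sel ⊓ kerloc) * _ ≤ _ at h
    rw [hM, hN, hL] at h
    have h' : Nat.card ↥(Sel ⊓ kerloc) * M ≤ (S * L) * M := by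
      calc Nat.card ↥(Sel ⊓ kerloc) * M
          ≤ Nat.card ↥(E.sha ⊓ AddSubgroup.torsionBy E.galH1 (n : ℤ)) * (M * L) := h
        _ ≤ S * (M * L) := Nat.mul_le_mul_right _ hS
        _ = (S * L) * M := by ring
    exact Nat.le_of_mul_le_mul_right h' (Nat.pos_of_ne_zero hM0)
  calc Sel.relIndex KO * Nat.card ↥(Sel ⊓ kerloc) ≤ L * (S * L) := Nat.mul_le_mul hB hA

end Level

end Summit.BirchSwinnertonDyer.Rank1Residual.X11b.SelmerLevelBound

end
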